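import Summits.Ventures.PercRepro.C026EdgeMonoLoopFree
import Summits.Ventures.PercRepro.C026DCSub

/-!
# CONJECTURE EM as a bound on the deletion–contraction defect (p5, gen 17)

mine-3's reading of EM through DC-SUB (`proofs/MINE3-EDGEMONO.md` §2, §5): with
`Δ_CF(H) = Δ_CF(H − e) + Δ_CF(H / e) − #DB(e)` (`slackCF_addEdge`, C026DCSub) for an edge `e = uv`
whose end `u` is not a mark, EM at `e` — `Δ_CF(H − e) ≤ Δ_CF(H)` — says exactly
`#DB(e) ≤ Δ_CF(H / e)`: «(CF) for the contraction with the room `DB(e)`». Here: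

* `isRelabel'_addEdge_delEdge_swap` — `(H − e) + (snd e)(fst e)` is `H` up to the orientation of
  `e` (p6's `IsRelabel'`);
* **`edgeMonoNL_iff_dcDefect_le`** — the loop-free form of EM holds iff for every marked
  multigraph `G` and every pair `u ∉ {a, b, c}`, `v ∉ {a, b, u}`:
  `#DB(uv) ≤ Δ_CF(G / uv)` (the defect counted in `G`, the contraction `G.contract u v`).
  Every loop-free off-mark edge has such an end `u` (if `fst e = c` take `u = snd e`).
-/

universe u v

namespace PercRepro

open Finset

namespace MultiGraph

section Defect

variable {V : Type u}

open Classical in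
/-- `(H − e₀) + (snd e₀)(fst e₀)` is a relabelling of `H` up to the orientation of `e₀`. -/
theorem isRelabel'_addEdge_delEdge_swap {E : Type v} (H : MultiGraph V E) (e₀ : E) :
    IsRelabel' ((H.part (delEdgeSide e₀) true).addEdge (H.snd e₀) (H.fst e₀)) H
      (delEdgeOptionEquiv e₀) := by
  rintro (_ | x)
  · exact Or.inr ⟨rfl, rfl⟩
  · exact Or.inl ⟨rfl, rfl⟩

open Classical in
/-- **EM, loop-free form, as the defect bound** (mine-3 §2): `EdgeMonoNL a b c` holds iff
`#DB(uv) ≤ Δ_CF(G / uv)` for every marked multigraph `G`, every non-mark `u` and every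
`v ∉ {a, b, u}`. -/
theorem edgeMonoNL_iff_dcDefect_le (a b c : V) :
    EdgeMonoNL.{u, v} a b c ↔
      ∀ (E : Type v) [Fintype E] (G : MultiGraph V E) (u v : V), u ≠ a → u ≠ b → u ≠ c →
        v ≠ u → v ≠ a → v ≠ b →
        ((univ.filter fun ω : Config E => G.DCDefect ω a b c u v).card : ℤ) ≤
          (G.contract u v).slackCF a b c := by
  constructor
  · intro hE E _ G u v hua hub huc hvu hva hvb
    have h := hE _ (G.addEdge u v) none (Ne.symm hvu) (fun h => h.elim hua hva)
      (fun h => h.elim hub hvb)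
    rw [slackCF_relabel (isRelabel_delEdge_addEdge G u v),
      slackCF_addEdge hvu hua.symm hub.symm huc.symm] at h
    linarith
  · intro h E _ H e hl hea heb
    have hfa : H.fst e ≠ a := fun h' => hea (Or.inl h')
    have hfb : H.fst e ≠ b := fun h' => heb (Or.inl h')
    have hsa : H.snd e ≠ a := fun h' => hea (Or.inr h')
    have hsb : H.snd e ≠ b := fun h' => heb (Or.inr h')
    by_cases hfc : H.fst e = c
    · -- the end `fst e` is `c`: contract from the other end
      have hsc : H.snd e ≠ c := fun h' => hl (hfc.trans h'.symm)
      have hb := h _ (H.part (delEdgeSide e) true) (H.snd e) (H.fst e) hsa hsb hsc hl hfa hfb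
      rw [← slackCF_relabel' (isRelabel'_addEdge_delEdge_swap H e),
        slackCF_addEdge hl hsa.symm hsb.symm hsc.symm]
      linarith
    · have hb := h _ (H.part (delEdgeSide e) true) (H.fst e) (H.snd e) hfa hfb hfc
        (Ne.symm hl) hsa hsb
      rw [← slackCF_relabel (isRelabel_addEdge_delEdge H e),
        slackCF_addEdge (Ne.symm hl) hfa.symm hfb.symm (Ne.symm hfc)]
      linarith

end Defect

end MultiGraph

end PercRepro
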